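import Summits.BirchSwinnertonDyer.BirchSwinnertonDyer.Theorems.RamifiedHeegnerPairLeafCartanNumOfPrintInputsThree
import HarnessLib

/-!
# Route `RamifiedHeegnerPair`, crux U₁ (stmt-BirchSwinnertonDyer-26022), line `nscartan` — NUM♮ part 4′: the class-blind certificate BY NAME
# (needs the (ISO)♮ def `CMRank.CoverIsotypicComponentNatural`, appended to `…CMRankDefs.lean` by p770883 — REVIEW-QUEUED at the time of writing)

HONEST FRAMING. Theorems only; CONDITIONAL closers of items 32276 / 32139 / 24801-signature on THREE NAMED print facts ((ISO)♮ `CMRank.CoverIsotypicComponentNatural`,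
`DeligneSerre1974.thm61_exists_adicGaloisRep`, `jacquetLanglands_cartanCover_newform`); credits nothing; nothing is closed; BSD is proved for no curve.
Lead prover bsd-line-rhp-p2 g54, 2026-08-30. [cite: KohenPacetti2016, Rem. 3.8 (arXiv:1403.7801v3 p. 15)] [cite: CaiShuTian2014, Prop. 3.8 p. 21]
-/

set_option linter.dupNamespace false
set_option autoImplicit false

namespace Summit.BirchSwinnertonDyer.BirchSwinnertonDyer.Theorems.LeafCartanNum

open Summit.BirchSwinnertonDyer.BirchSwinnertonDyer.Theorems Literature.NumberTheory.Automorphic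
  Literature.NumberTheory.EllipticCurves.ModularForms

/-- **NUM♮ (item stmt-BirchSwinnertonDyer-32276) from three NAMED print facts.** [cite: KohenPacetti2016, Rem. 3.8 (arXiv:1403.7801v3 p. 15)] -/
theorem cartanOnePlaceDegreeLawAtThreeNatural_of_namedPrintFacts (hISO : CartanCover.CMRank.CoverIsotypicComponentNatural)
    (h61 : DeligneSerre1974.thm61_exists_adicGaloisRep) (hJL : jacquetLanglands_cartanCover_newform) :
    CartanCorrespondence.CartanOnePlaceDegreeLawAtThreeNatural :=
  cartanOnePlaceDegreeLawAtThreeNatural_of_printInputsThree (fun V _ _ => hISO V) h61 hJL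

/-- **NUM_leaf (item stmt-BirchSwinnertonDyer-32139) from three NAMED print facts.** [cite: KohenPacetti2016, Rem. 3.8 (arXiv:1403.7801v3 p. 15)] -/
theorem leafCartanOnePlaceDegreeLawAtThree_of_namedPrintFacts (hISO : CartanCover.CMRank.CoverIsotypicComponentNatural)
    (h61 : DeligneSerre1974.thm61_exists_adicGaloisRep) (hJL : jacquetLanglands_cartanCover_newform) :
    Summit.BirchSwinnertonDyer.BirchSwinnertonDyer.Theses.RamifiedHeegnerPair.LeafCartanOnePlaceDegreeLawAtThree :=
  leafCartanOnePlaceDegreeLawAtThree_of_printInputsThree (fun V _ _ => hISO V) h61 hJL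

/-- **NUM (item 24801's signature) from three NAMED print facts.** [cite: KohenPacetti2016, Rem. 3.8 (arXiv:1403.7801v3 p. 15)] -/
theorem cartanOnePlaceDegreeLawAtThree_of_namedPrintFacts (hISO : CartanCover.CMRank.CoverIsotypicComponentNatural)
    (h61 : DeligneSerre1974.thm61_exists_adicGaloisRep) (hJL : jacquetLanglands_cartanCover_newform) :
    CartanCorrespondence.CartanOnePlaceDegreeLawAtThree :=
  cartanOnePlaceDegreeLawAtThree_of_printInputsThree_natural (fun V _ _ => hISO V) h61 hJL

end Summit.BirchSwinnertonDyer.BirchSwinnertonDyer.Theorems.LeafCartanNum
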